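import Summits.Ventures.CertifiedManyBodySolver.Downfold.PhaseMapBandClasses
import Summits.Ventures.CertifiedManyBodySolver.Downfold.PhaseMapTablePooling
import HarnessLib

/-!
# The §7 «inside-band ≥ 0.80» clause keys the CREDIT tally, which is never above the interval tally: what the e-ph clause of record
# (1/2) needs to flip, by kernel

Venture CertifiedManyBodySolver, cell `pub/hubbard-downfold`, seat hubbard-downfold-score-1 (second scoring engine);
namespace `Summit.Ventures.CertifiedManyBodySolver.Downfold.CellScore`. ACCEPTANCE §4.4 (per SC truth column with a band: INSIDE iff
T_c ∈ [lo − τ, hi + τ]; v1.3 CREDIT RULE: credit iff INSIDE ∧ class ≠ uninformative; the «interval» fraction counts INSIDE regardless of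
class; printed «inside-band credit x [e-ph x] (n; interval x; uninformative-denied k …)»), §7 («inside-band ≥ 0.80 on the e–ph branch» READ
as the CREDIT fraction, v1.3). REUSES `inside`/`infoClass`/`credit` (PhaseMapBandClasses p469360, PhaseMapCellScore p463097) and
`Tally`/`meets`/`ratio` (PhaseMapTablePooling p478346) by import. Everything here is PROVED.

WHAT THIS IS NOT: a T_c estimate or a statement about any band of record. It is the KERNEL REFERENCE for:

* §1 a column = (lo, hi, Tc, τ); `nInside`, `nCredit`, tallies `intervalTally` / `creditTally` over a list of band columns (denominator
  = number of banded SC columns).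
* §2 `nCredit_le_nInside` (credit ⇒ inside, column by column) ⇒ `creditTally_meets_imp_interval` (if the CREDIT clause meets θ so does
  the interval reading — the §7 clause keys the STRICTER number) and the converse failure `interval_meets_credit_fails` (a lone [0, 300] K
  band: interval 1/1 passes everything, credit 0/1 fails everything = «uninformative-denied»).
* §3 what flips the clause: `credit_all_meets` (every column credited ⇒ the tally meets every θ ≤ 1), `credit_clause_two_columns` (with two
  e-ph columns the 0.80 floor needs BOTH credited: 1/2 fails, 2/2 passes) — the exact condition score-2's WORKED-EXAMPLES-STATUS states in
  prose for TV1.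
* §4 numbers of record (runs #4–#6, both engines): e-ph columns with truth and a band n = 2 — M02 Pb @0 [4.976, 9.577] K vs 7.2 K (τ 1)
  INSIDE, class moderate ⇒ credited; M03 Nb @0 [12.575, 19.957] K vs 9.25 K (τ 1) OUTSIDE (miss-high 2.325 K beyond τ) ⇒ no credit ⇒
  credit 1/2 FAILS 0.80 (and interval 1/2 too: nothing was denied for width); a Nb band with lo ≤ 10.25 K (and informative) flips it to 2/2.
-/

namespace Summit.Ventures.CertifiedManyBodySolver.Downfold

namespace CellScore

/-! ## §1 Columns and the two tallies -/

/-- One SC truth column carrying a band: `[lo, hi]` K, measured `Tc`, tolerance `τ`. [folklore] -/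
structure BandCol where
  /-- band lower edge (K) -/
  lo : ℚ
  /-- band upper edge (K) -/
  hi : ℚ
  /-- measured T_c [float] (K) -/
  Tc : ℚ
  /-- tolerance τ = max(Tc_err, 1 K, 0.05·Tc) -/
  τ : ℚ
  deriving DecidableEq, Repr

/-- the column is INSIDE (§4.4). [folklore] -/
def BandCol.isInside (c : BandCol) : Bool := inside c.lo c.hi c.Tc c.τ

/-- the column is CREDITED (v1.3 rule). [folklore] -/
def BandCol.isCredit (c : BandCol) : Bool := credit c.lo c.hi c.Tc c.τ

/-- number of INSIDE columns. [folklore] -/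
def nInside : List BandCol → ℕ
  | [] => 0
  | c :: cs => (if c.isInside then 1 else 0) + nInside cs

/-- number of CREDITED columns. [folklore] -/
def nCredit : List BandCol → ℕ
  | [] => 0
  | c :: cs => (if c.isCredit then 1 else 0) + nCredit cs

/-- the «interval» reading: INSIDE / banded columns. [folklore] -/
def intervalTally (cs : List BandCol) : Tally := ⟨nInside cs, cs.length⟩

/-- the CREDIT tally the §7 clause keys (v1.3 reading). [folklore] -/
def creditTally (cs : List BandCol) : Tally := ⟨nCredit cs, cs.length⟩

/-! ## §2 Credit is the stricter number -/

/-- credit ⇒ inside, per column. [folklore] -/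
theorem isInside_of_isCredit (c : BandCol) (h : c.isCredit = true) : c.isInside = true := by
  simp only [BandCol.isCredit, credit_eq_true_iff] at h
  exact h.1

/-- Hence the credited count never exceeds the inside count. [folklore] -/
theorem nCredit_le_nInside (cs : List BandCol) : nCredit cs ≤ nInside cs := by
  induction cs with
  | nil => simp [nCredit, nInside]
  | cons c cs ih =>
    simp only [nCredit, nInside]
    by_cases h : c.isCredit = true
    · simp [h, isInside_of_isCredit c h]; exact ih
    · rw [Bool.not_eq_true] at h
      simp only [h, Bool.false_eq_true, if_false, Nat.zero_add]
      omega

/-- THE §7 CLAUSE KEYS THE STRICTER NUMBER: if the credit tally meets a floor, so does the interval reading. [folklore] -/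
theorem creditTally_meets_imp_interval (cs : List BandCol) (θ : ℚ) (h : (creditTally cs).meets θ = true) :
    (intervalTally cs).meets θ = true := by
  rw [Tally.meets_eq_true_iff] at h ⊢
  simp only [creditTally, intervalTally] at h ⊢
  have : (nCredit cs : ℚ) ≤ nInside cs := by exact_mod_cast nCredit_le_nInside cs
  linarith

/-- … and NOT conversely («uninformative-denied»): the lone band [0, 300] K around T_c = 39 K (τ 2) is INSIDE — interval 1/1 meets every
floor ≤ 1 — but uninformative, so credit 0/1 FAILS every positive floor. [folklore] -/
theorem interval_meets_credit_fails :
    let cs := [BandCol.mk 0 300 39 2]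
    intervalTally cs = ⟨1, 1⟩ ∧ creditTally cs = ⟨0, 1⟩ ∧ (intervalTally cs).meets (4 / 5) = true ∧ (creditTally cs).meets (4 / 5) = false := by
  have hin : (BandCol.mk 0 300 39 2).isInside = true := by
    rw [BandCol.isInside, inside_iff]; norm_num
  have hcr : (BandCol.mk 0 300 39 2).isCredit = false := by
    rw [BandCol.isCredit]; exact credit_zero_lo_eq_false (by norm_num)
  have h1 : intervalTally [BandCol.mk 0 300 39 2] = ⟨1, 1⟩ := by simp [intervalTally, nInside, hin]
  have h2 : creditTally [BandCol.mk 0 300 39 2] = ⟨0, 1⟩ := by simp [creditTally, nCredit, hcr]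
  refine ⟨h1, h2, ?_, ?_⟩
  · rw [h1, Tally.meets_eq_true_iff]; norm_num
  · rw [h2, Tally.meets_eq_false_iff]; norm_num

/-! ## §3 What flips the clause -/

/-- If EVERY banded column is credited the credit tally meets every floor θ ≤ 1. [folklore] -/
theorem credit_all_meets (cs : List BandCol) (h : ∀ c ∈ cs, c.isCredit = true) (θ : ℚ) (hθ : θ ≤ 1) :
    (creditTally cs).meets θ = true := by
  have hn : nCredit cs = cs.length := by
    induction cs with
    | nil => rfl
    | cons c cs ih =>
      simp only [nCredit, List.length_cons, h c (by simp), if_true]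
      rw [ih (fun d hd => h d (by simp [hd]))]; omega
  rw [Tally.meets_eq_true_iff]; simp only [creditTally, hn]
  have : (0 : ℚ) ≤ cs.length := by exact_mod_cast Nat.zero_le _
  nlinarith

/-- With TWO e-ph columns the 0.80 floor needs BOTH credited: 1 of 2 fails, 2 of 2 passes. [folklore] -/
theorem credit_clause_two_columns :
    (Tally.mk 1 2).meets (4 / 5) = false ∧ (Tally.mk 2 2).meets (4 / 5) = true := by
  constructor
  · rw [Tally.meets_eq_false_iff]; norm_num
  · rw [Tally.meets_eq_true_iff]; norm_num

/-- More generally k of n credited meets 0.80 iff 5k ≥ 4n (so 4/5, 8/10 pass; 3/4, 7/9 fail). [folklore] -/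
theorem credit_meets_four_fifths_iff (k n : ℕ) : (Tally.mk k n).meets (4 / 5) = true ↔ 4 * n ≤ 5 * k := by
  rw [Tally.meets_eq_true_iff]
  constructor
  · intro h
    have : (4 : ℚ) * n ≤ 5 * k := by simp only at h; linarith
    exact_mod_cast this
  · intro h
    have : (4 : ℚ) * n ≤ 5 * k := by exact_mod_cast h
    simp only; linarith

/-! ## §4 Numbers of record: the two e-ph band columns of runs #4–#6 (both engines) -/

/-- M02 Pb @ 0 GPa: hubbard-eph band [4.976, 9.577] K vs measured 7.2 K, τ = 1 K. [folklore] -/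
def pbCol : BandCol := ⟨4976 / 1000, 9577 / 1000, 36 / 5, 1⟩

/-- M03 Nb @ 0 GPa: band [12.575, 19.957] K vs measured 9.25 K, τ = 1 K. [folklore] -/
def nbCol : BandCol := ⟨12575 / 1000, 19957 / 1000, 37 / 4, 1⟩

/-- Pb is INSIDE and CREDITED (class moderate: relative half-width 0.316 > 1/4, ≤ 1/2). [folklore] -/
theorem pb_credited : pbCol.isInside = true ∧ pbCol.isCredit = true := by
  have hin : pbCol.isInside = true := by
    rw [BandCol.isInside, pbCol, inside_iff]; norm_num
  refine ⟨hin, ?_⟩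
  rw [BandCol.isCredit, pbCol]
  exact credit_of_inside_of_le_four_mul (by rw [BandCol.isInside, pbCol] at hin; exact hin) (by norm_num)

/-- Nb is OUTSIDE (T_c + τ = 10.25 K < lo = 12.575 K: miss-high 2.325 K beyond tolerance) hence not credited. [folklore] -/
theorem nb_outside : nbCol.isInside = false ∧ nbCol.isCredit = false := by
  have hout : nbCol.isInside = false := by
    rw [BandCol.isInside, nbCol]
    rw [Bool.eq_false_iff, ne_eq, inside_iff]; norm_num
  refine ⟨hout, ?_⟩
  rw [Bool.eq_false_iff]; intro h
  have := isInside_of_isCredit nbCol h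
  rw [hout] at this; exact Bool.false_ne_true this

/-- THE CLAUSE OF RECORD: credit 1/2 (and interval 1/2 — nothing denied for width) FAILS 0.80 ⇒ «inside-band(e-ph branch)» is in the
failing list of runs #4–#6; a re-issued Nb band with lo ≤ 10.25 K and class ≠ uninformative makes it 2/2 = PASS. [folklore] -/
theorem eph_credit_of_record :
    creditTally [pbCol, nbCol] = ⟨1, 2⟩ ∧ intervalTally [pbCol, nbCol] = ⟨1, 2⟩ ∧ (creditTally [pbCol, nbCol]).meets (4 / 5) = false := by
  have h1 : creditTally [pbCol, nbCol] = ⟨1, 2⟩ := by simp [creditTally, nCredit, pb_credited.2, nb_outside.2]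
  have h2 : intervalTally [pbCol, nbCol] = ⟨1, 2⟩ := by simp [intervalTally, nInside, pb_credited.1, nb_outside.1]
  exact ⟨h1, h2, by rw [h1]; exact credit_clause_two_columns.1⟩

/-- A hypothetical re-issued Nb band [8.5, 10.5] K (informative, INSIDE 9.25 ± 1) would flip the clause: 2/2 meets 0.80. [folklore] -/
theorem eph_credit_flip :
    let nb' : BandCol := ⟨17 / 2, 21 / 2, 37 / 4, 1⟩
    nb'.isCredit = true ∧ (creditTally [pbCol, nb']).meets (4 / 5) = true := by
  have hin : inside (17 / 2) (21 / 2) (37 / 4) 1 = true := by rw [inside_iff]; norm_num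
  have hc : (BandCol.mk (17 / 2) (21 / 2) (37 / 4) 1).isCredit = true := by
    rw [BandCol.isCredit]; exact credit_of_inside_of_le_four_mul hin (by norm_num)
  refine ⟨hc, ?_⟩
  have : creditTally [pbCol, BandCol.mk (17 / 2) (21 / 2) (37 / 4) 1] = ⟨2, 2⟩ := by simp [creditTally, nCredit, pb_credited.2, hc]
  rw [this]; exact credit_clause_two_columns.2

/-! ## §5 (appended 2026-08-27 g6) RUN #12: the clause crossed 0.80 — on ONE material's three pressure columns

RUN #12 (maps/run-2026-08-27g, both engines, PEN PARITY 0/0): the banded e-ph columns with truth are now FIVE — Pb @0 (credited), Nb @0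
(outside), and LaH₁₀ (M09) @150 / @170 / @200 GPa with hubbard-eph bands [125.704, 320.806] / [128.413, 315.349] / [128.413, 309.891] K vs
measured 249 ± 8 / 250 ± 6 / 245 ± 15 K (τ = max(err, 1, 0.05·T_c) = 12.45 / 12.5 / 15 K), each INSIDE and class moderate (relative
half-width 0.437 / 0.421 / 0.414) ⇒ credited. Credit 4/5 = 0.80 meets the floor EXACTLY (4·5 ≤ 5·4 with equality): the §7 clause left the
failing list for the first time. Two facts the line of record should carry beside «PASS»: (i) the clause is COLUMN-weighted (§4.4 «per
(material, P, H) column»): the three M09 columns come from one material and one band family — weighted per MATERIAL the same data read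
2/3 < 0.80 (`run12_eph_credit_by_material`); (ii) the pass is KNIFE-EDGE: one more banded e-ph column that is not credited makes it 4/6 and
the clause fails again (`run12_eph_credit_fragile`), while one more credited column makes it 5/6. -/

/-- M09 LaH₁₀ @150 GPa: band [125.704, 320.806] K vs 249 ± 8 K, τ = max(8, 1, 0.05·249) = 12.45 K. [folklore] -/
def la150 : BandCol := ⟨125704 / 1000, 320806 / 1000, 249, 249 / 20⟩

/-- M09 LaH₁₀ @170 GPa: band [128.413, 315.349] K vs 250 ± 6 K, τ = 12.5 K. [folklore] -/
def la170 : BandCol := ⟨128413 / 1000, 315349 / 1000, 250, 25 / 2⟩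

/-- M09 LaH₁₀ @200 GPa: band [128.413, 309.891] K vs 245 ± 15 K, τ = 15 K. [folklore] -/
def la200 : BandCol := ⟨128413 / 1000, 309891 / 1000, 245, 15⟩

/-- All three LaH₁₀ columns are INSIDE and CREDITED (hi ≤ 4·lo ⇒ class ≠ uninformative). [folklore] -/
theorem la_credited : la150.isCredit = true ∧ la170.isCredit = true ∧ la200.isCredit = true := by
  refine ⟨?_, ?_, ?_⟩
  · rw [BandCol.isCredit, la150]; exact credit_of_inside_of_le_four_mul (by rw [inside_iff]; norm_num) (by norm_num)
  · rw [BandCol.isCredit, la170]; exact credit_of_inside_of_le_four_mul (by rw [inside_iff]; norm_num) (by norm_num)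
  · rw [BandCol.isCredit, la200]; exact credit_of_inside_of_le_four_mul (by rw [inside_iff]; norm_num) (by norm_num)

/-- RUN #12's CLAUSE: credit tally over the five banded e-ph columns = 4/5, which meets 0.80 — exactly at the floor. [folklore] -/
theorem run12_eph_credit :
    creditTally [pbCol, nbCol, la150, la170, la200] = ⟨4, 5⟩ ∧ (creditTally [pbCol, nbCol, la150, la170, la200]).meets (4 / 5) = true := by
  have h : creditTally [pbCol, nbCol, la150, la170, la200] = ⟨4, 5⟩ := by
    simp [creditTally, nCredit, pb_credited.2, nb_outside.2, la_credited.1, la_credited.2.1, la_credited.2.2]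
  exact ⟨h, by rw [h]; exact (credit_meets_four_fifths_iff 4 5).mpr (by norm_num)⟩

/-- (i) Weighted per MATERIAL (Pb credited, Nb not, LaH₁₀ credited on all its columns) the same data read 2/3, which FAILS 0.80 —
the column weighting of §4.4 is what carried the clause. [folklore] -/
theorem run12_eph_credit_by_material : (Tally.mk 2 3).meets (4 / 5) = false := by
  rw [Bool.eq_false_iff, ne_eq, credit_meets_four_fifths_iff]; omega

/-- (ii) Knife-edge: a sixth banded e-ph column that is NOT credited ⇒ 4/6 fails; one that IS credited ⇒ 5/6 meets. [folklore] -/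
theorem run12_eph_credit_fragile : (Tally.mk 4 6).meets (4 / 5) = false ∧ (Tally.mk 5 6).meets (4 / 5) = true := by
  constructor
  · rw [Bool.eq_false_iff, ne_eq, credit_meets_four_fifths_iff]; omega
  · exact (credit_meets_four_fifths_iff 5 6).mpr (by norm_num)

end CellScore

end Summit.Ventures.CertifiedManyBodySolver.Downfold
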